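import Summits.ResolutionOfSingularities.ResolutionOfSingularities.Theorems.UniformComplexityCampaignW82TwistNormalRing
import Summits.ResolutionOfSingularities.ResolutionOfSingularities.Theorems.UniformComplexityCampaignW82HypersurfaceBaseChange
import Summits.ResolutionOfSingularities.ResolutionOfSingularities.Theorems.UniversalCellsCampaignW82FrobeniusTwistRungs
import Summits.ResolutionOfSingularities.ResolutionOfSingularities.Theorems.UniversalCellsCampaignW82GeometricallyReduced
import Literature.AlgebraicGeometry.Resolution.FiniteBirationalNormal
import Literature.AlgebraicGeometry.Resolution.ProjectiveSpaceRegular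
import Literature.AlgebraicGeometry.Resolution.SmoothStalksRegular
import Literature.AlgebraicGeometry.Motives.GoodReductionSpecialFibreProofs
import Mathlib.FieldTheory.IsAlgClosed.AlgebraicClosure
import Mathlib.FieldTheory.PurelyInseparable.PerfectClosure
import Mathlib.RingTheory.KrullDimension.NonZeroDivisors
import Mathlib.RingTheory.Spectrum.Prime.Topology
import HarnessLib

/-!
# [OURS · L1 W8.2] NORMALISING THE FROBENIUS TWISTS NEVER SUFFICES (dimension 2): the surface `x^p − t = yz`

Cell `res-hironaka` (run/shared/lean/pub/res-hironaka/), LADDER-RESOLUTION rung L (RESCUE), slot W8.2 of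
plan/RESCUE-SEED.md («PRIME-FIELD / UNIVERSALITY TRANSFER instead of descent»), door 2 = route
`UniformComplexity`, host item `PrimeModelTransfer` (stmt-ResolutionOfSingularities-8933); prover
res-L1-s82-pv-2 (gen 4). THESES-FREE module (imports the gen-4 siblings `…TwistNormalRing` (the `A_{p−1}` ring
`ApQuot L p = L[u,y,z]/(u^p − yz)`: `isDomain_apQuot`, `isIntegrallyClosed_apQuot`, `not_isRegularRing_apQuot`) and
`…HypersurfaceBaseChange` (`pullbackHypIso`, `specIsoOfRingEquiv`), res-L1-s82-pv-1's `…FrobeniusTwistRungs`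
(`HasSmoothFrobeniusTwistModel`, `IntegralOverPerfectClosure`, `hasSmoothFrobeniusTwistModel_of_dim_le_three`) and
`…GeometricallyReduced` (`IntegralOverPerfectClosure.isIntegral`), the Literature files
`Resolution.FiniteBirationalNormal` (`isIso_of_isFinite_of_isBirational`), `Resolution.ProjectiveSpaceRegular`
(`Scheme.isRegular_Spec_iff`), `Resolution.SmoothStalksRegular` (`isRegularLocalRing_stalk_of_smooth_of_field`),
`Motives.GoodReductionSpecialFibreProofs` (`isIntegrallyClosed_stalk_Spec`), Mathlib, `HarnessLib`).

[OURS · L1 W8.2] replaces the role of no printed item; NOT a statement of H. Hironaka's manuscript. NEGATIVE RUNG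
on the MECHANISM side of the slot's residual (`CampaignW82.FrobeniusTwistStepRegularAt p M n`: «some Frobenius
twist `X₀ ×_{K,Frob^e} K` has a proper birational model SMOOTH over `K`»): the kernel-checked form, for EVERY prime
`p`, of near-miss (s2) of Cruxes/PrimeFieldToPerfect/Disproof.lean («NORMALISE the twists, never re-resolve» is
false from dimension 2; strategist census N3; there `u^p + y² + z²`, `p` odd, `sorry`), in the split form
`x^p − t = yz`:

* §7 the surface `Y_t = Spec K[x,y,z]/(x^p − t − yz)` over any field `K` (`surf`, `surfTo`); base change along
  `φ : K → L` is `Y_{φ t}` (`baseChangeIso`), and if `φ(t) = τ^p` in `L` then, after the shift `x ↦ x + τ`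
  (`shiftEquiv`, `(x+τ)^p = x^p + τ^p`), it is the `A_{p−1}` SURFACE `Spec L[u,y,z]/(u^p − yz)`
  (`baseChangeIsoApQuot`, over `Spec L`: `baseChangeIsoApQuot_hom_comp`);
* §8 hence every such base change is INTEGRAL (`isIntegral_baseChange`), NORMAL (`isIntegrallyClosed_stalk_baseChange`)
  and NOT SMOOTH over `L` (`not_smooth_baseChange`: smooth over a field ⇒ regular local rings, but the origin of
  the `A_{p−1}` surface is not regular), and NO FINITE birational modification of it from an integral scheme is
  smooth (`no_smooth_finite_model_baseChange`: finite birational onto normal is an isomorphism);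
* §9 the instances: the FROBENIUS TWISTS `Y_t ×_{K,Frob^{k+1}} K` (`τ = t^{p^k}`) —
  **`no_smooth_finite_model_twist`**: for every `p`, `K`, `t`, every level `m ≥ 1`, no finite birational
  modification (the normalisation, the identity, …) of the `m`-th twist of `Y_t` is smooth over `K`
  (`isIntegral_twist`, `isIntegrallyClosed_stalk_twist`, `not_smooth_twist`); and the perfect closure /
  algebraic closure (`τ = t^{1/p}`): `integralOverPerfectClosure_surf` (`Y_t` is geometrically integral in the
  sense of the residual's hypothesis `IntegralOverPerfectClosure`), `not_smooth_surfTo` (`Y_t` is not smooth over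
  `K`, any `t`), `isIntegral_surf`, `locallyOfFiniteType_surfTo`, `topologicalKrullDim_surf_le_two`; and
  `hasSmoothFrobeniusTwistModel_surf` (⇐ FACT-LIST F-02 `CossartPiltant2019`, via pv-1's dimension-`≤ 3` rung):
  the `∃`-model of the residual DOES exist for `Y_t` — it is a RESOLUTION of the `A_{p−1}` point, never a
  normalisation.

Reading for the slot: for curves (n = 1) the residual is proved by «twist enough, then NORMALISE»
(`hasSmoothFrobeniusTwistModel_of_dim_le_one`; the level is unbounded — gen 3/4 rungs
`frobeniusTwist_exponent_unbounded(_regular)`); from n = 2 on this mechanism is dead at EVERY level: the twisted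
levels carry genuine singularities (here `A_{p−1}`) that only blow-ups remove. Together: any proof of
`FrobeniusTwistStepRegularAt p M n` (n ≥ 2) must choose an `X₀`-dependent level AND resolve there. For `t ∉ K^p`
(e.g. `t = RatFunc.X` over `M(t)`) `Y_t` is moreover REGULAR (maximal ideal `(y, z)` at the inseparable point) —
a regular, geometrically integral, non-smooth surface, the two-dimensional sibling of Kollár's curve; its
regularity is not needed for, and not proved in, this file.

HONEST FRAMING. OURS bookkeeping about an OURS statement; classical mathematics (Shepherd-Barron's remark that
families inside the discriminant need an inseparable base change AND a resolution: `xy + z² + t = 0`); NOT a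
statement of H. Hironaka's 2017 manuscript ([Hironaka2017]); nothing is attributed to its author. It says nothing
about the open grades `n ≥ 4` of the residual beyond «normalisation is not the mechanism». AI work, weaker than
expert review. No `sorry`, no new axioms.

## References (vocabulary and locators only)
* N. Shepherd-Barron, arXiv:1711.10439, Remark 2(1). [ShepherdBarron2017]
* Zs. Patakfalvi, J. Waldron, arXiv:1708.04268, Thm 1.1 and §2.4. [PatakfalviWaldron]
* The Stacks Project, Tags 035Q / 0AB1 (finite birational onto normal is an isomorphism), 056S (smooth over a
  field is regular). [StacksProject]
* Cruxes/PrimeFieldToPerfect/Disproof.lean §4 (s2); Cruxes/PrimeModelTransfer/STRATEGY-CENSUS.md N3;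
  L/res-L1-s82-pv-2/NOTES.md (gen 4).
-/

noncomputable section

set_option linter.dupNamespace false -- mandated namespace of this single-conjunct summit

open Polynomial IsLocalRing TensorProduct
open _root_.CategoryTheory _root_.CategoryTheory.Limits _root_.AlgebraicGeometry

namespace Summit.ResolutionOfSingularities.ResolutionOfSingularities.Theorems.CampaignW82.TwistNormal

open Literature.AlgebraicGeometry.Resolution

/-! ## §7 The surface `Y_t : x^p − t = yz` over `K`; base change along `φ : K → L` -/

section Surface

variable (K : Type) [Field K] (p : ℕ) (t : K)

/-- `h_t = X₀^p − t − X₁X₂ ∈ K[X₀,X₁,X₂]` (`x = X₀`, `y = X₁`, `z = X₂`). [folklore] -/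
def surfPoly : MvPolynomial (Fin 3) K :=
  MvPolynomial.X 0 ^ p - MvPolynomial.C t - MvPolynomial.X 1 * MvPolynomial.X 2

/-- The surface `Y_t = Spec K[x,y,z]/(x^p − t − yz)`. [folklore] -/
abbrev surf : Scheme.{0} := hypSpec K (surfPoly K p t)

/-- Its structure morphism `Y_t ⟶ Spec K`. [folklore] -/
abbrev surfTo : surf K p t ⟶ Spec (.of K) := hypTo K (surfPoly K p t)

variable {K} in
/-- `φ(h_t) = h_{φ t}`. [folklore] -/
theorem map_surfPoly {L : Type} [Field L] (φ : K →+* L) :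
    MvPolynomial.map φ (surfPoly K p t) = surfPoly L p (φ t) := by
  simp [surfPoly, MvPolynomial.map_X]

/-- **Base change of `Y_t` along `φ : K → L` is `Y_{φ t}`** (over `L`). [folklore] -/
def baseChangeIso {L : Type} [Field L] (φ : K →+* L) :
    pullback (surfTo K p t) (Spec.map (CommRingCat.ofHom φ)) ≅ surf L p (φ t) :=
  pullbackHypIso K (surfPoly K p t) L φ ≪≫
    specIsoOfRingEquiv (Ideal.quotEquivOfEq (R := MvPolynomial (Fin 3) L) (by rw [map_surfPoly]))

/-- `baseChangeIso` lies over `Spec L`. [folklore] -/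
theorem baseChangeIso_hom_comp {L : Type} [Field L] (φ : K →+* L) :
    (baseChangeIso K p t φ).hom ≫ surfTo L p (φ t) =
      pullback.snd (surfTo K p t) (Spec.map (CommRingCat.ofHom φ)) := by
  rw [baseChangeIso, Iso.trans_hom, Category.assoc,
    specIsoOfRingEquiv_hom_comp _ (fun k => Ideal.quotEquivOfEq_mk _ _)]
  exact pullbackHypIso_hom_comp K (surfPoly K p t) L φ

/-- **The shift `x ↦ x + τ`**: an `L`-algebra automorphism of `L[x,y,z]`. [folklore] -/
def shiftEquiv (L : Type) [Field L] (τ : L) : MvPolynomial (Fin 3) L ≃ₐ[L] MvPolynomial (Fin 3) L :=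
  AlgEquiv.ofAlgHom
    (MvPolynomial.aeval ![MvPolynomial.X 0 + MvPolynomial.C τ, MvPolynomial.X 1, MvPolynomial.X 2])
    (MvPolynomial.aeval ![MvPolynomial.X 0 - MvPolynomial.C τ, MvPolynomial.X 1, MvPolynomial.X 2])
    (by
      refine MvPolynomial.algHom_ext fun i => ?_
      fin_cases i <;> simp)
    (by
      refine MvPolynomial.algHom_ext fun i => ?_
      fin_cases i <;> simp)

/-- `x ↦ x + τ` sends `h_{τ^p}` to `f = x^p − yz` (characteristic `p`: `(x + τ)^p = x^p + τ^p`). [folklore] -/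
theorem shiftEquiv_surfPoly (L : Type) [Field L] [hp : Fact p.Prime] [CharP L p] (τ : L) :
    shiftEquiv L τ (surfPoly L p (τ ^ p)) = apPoly L p := by
  haveI : CharP (MvPolynomial (Fin 3) L) p := inferInstance
  simp only [shiftEquiv, AlgEquiv.ofAlgHom_apply, surfPoly, apPoly, map_sub, map_pow, map_mul,
    MvPolynomial.aeval_X, MvPolynomial.algHom_C, MvPolynomial.algebraMap_eq, Matrix.cons_val_zero,
    Matrix.cons_val_one, Matrix.cons_val_two, Matrix.head_cons, Matrix.tail_cons]
  rw [add_pow_char, ← map_pow]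
  ring

/-- **`L[x,y,z]/(x^p − τ^p − yz) ≅ L[u,y,z]/(u^p − yz)`** (`u = x − τ`). [folklore] -/
def surfRingEquivApQuot (L : Type) [Field L] [Fact p.Prime] [CharP L p] (τ : L) :
    HypRing L (surfPoly L p (τ ^ p)) ≃+* ApQuot L p :=
  Ideal.quotientEquiv (Ideal.span {surfPoly L p (τ ^ p)}) (Ideal.span {apPoly L p})
    (shiftEquiv L τ).toRingEquiv (by
      rw [Ideal.map_span, Set.image_singleton]
      exact congrArg _ (congrArg _ (shiftEquiv_surfPoly p L τ).symm))

/-- The isomorphism is `L`-linear on constants. [folklore] -/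
theorem surfRingEquivApQuot_algebraMap (L : Type) [Field L] [Fact p.Prime] [CharP L p] (τ : L) (l : L) :
    surfRingEquivApQuot p L τ (algebraMap L _ l) = algebraMap L (ApQuot L p) l := by
  change surfRingEquivApQuot p L τ (Ideal.Quotient.mk _ (MvPolynomial.C l)) = Ideal.Quotient.mk _ (MvPolynomial.C l)
  rw [surfRingEquivApQuot, Ideal.quotientEquiv_mk]
  congr 1
  change shiftEquiv L τ (MvPolynomial.C l) = MvPolynomial.C l
  simp [shiftEquiv]

/-- **`Y_{τ^p} ≅ Spec L[u,y,z]/(u^p − yz)` over `L`.** [folklore] -/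
def surfIsoApQuot (L : Type) [Field L] [Fact p.Prime] [CharP L p] (τ : L) :
    surf L p (τ ^ p) ≅ Spec (.of (ApQuot L p)) :=
  specIsoOfRingEquiv (surfRingEquivApQuot p L τ)

/-- `surfIsoApQuot` lies over `Spec L`. [folklore] -/
theorem surfIsoApQuot_hom_comp (L : Type) [Field L] [Fact p.Prime] [CharP L p] (τ : L) :
    (surfIsoApQuot p L τ).hom ≫ Spec.map (CommRingCat.ofHom (algebraMap L (ApQuot L p))) =
      surfTo L p (τ ^ p) :=
  specIsoOfRingEquiv_hom_comp _ (surfRingEquivApQuot_algebraMap p L τ)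

/-- **Base change of `Y_t` to a field `L ∋ τ` with `τ^p = φ(t)` is the `A_{p−1}` surface `Spec L[u,y,z]/(u^p − yz)`.**
Instances: `φ = Frob^{k+1} : K → K` with `τ = t^{p^k}` (the Frobenius TWISTS of level `≥ 1`); `φ : K → K^{perf}`
or `K → K̄` with `τ = t^{1/p}`. [folklore] -/
def baseChangeIsoApQuot {L : Type} [Field L] [Fact p.Prime] [CharP L p] (φ : K →+* L) (τ : L)
    (hτ : τ ^ p = φ t) :
    pullback (surfTo K p t) (Spec.map (CommRingCat.ofHom φ)) ≅ Spec (.of (ApQuot L p)) :=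
  baseChangeIso K p t φ ≪≫
    specIsoOfRingEquiv (Ideal.quotEquivOfEq (R := MvPolynomial (Fin 3) L) (by rw [hτ])) ≪≫ surfIsoApQuot p L τ

/-- `baseChangeIsoApQuot` lies over `Spec L`. [folklore] -/
theorem baseChangeIsoApQuot_hom_comp {L : Type} [Field L] [Fact p.Prime] [CharP L p] (φ : K →+* L) (τ : L)
    (hτ : τ ^ p = φ t) :
    (baseChangeIsoApQuot K p t φ τ hτ).hom ≫ Spec.map (CommRingCat.ofHom (algebraMap L (ApQuot L p))) =
      pullback.snd (surfTo K p t) (Spec.map (CommRingCat.ofHom φ)) := by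
  rw [baseChangeIsoApQuot, Iso.trans_hom, Iso.trans_hom, Category.assoc, Category.assoc, surfIsoApQuot_hom_comp,
    specIsoOfRingEquiv_hom_comp _ (fun k => Ideal.quotEquivOfEq_mk _ _)]
  exact baseChangeIso_hom_comp K p t φ

end Surface

/-! ## §8 Such base changes are INTEGRAL, NORMAL and NOT SMOOTH; no finite birational modification is smooth -/

section BaseChangeFacts

variable (K : Type) [Field K] (p : ℕ) [hp : Fact p.Prime] (t : K) {L : Type} [Field L] [CharP L p]
  (φ : K →+* L) (τ : L) (hτ : τ ^ p = φ t)

include hτ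

/-- The base change is an integral scheme. [folklore] -/
theorem isIntegral_baseChange : IsIntegral (pullback (surfTo K p t) (Spec.map (CommRingCat.ofHom φ))) :=
  haveI := isDomain_apQuot L p
  IsIntegral.of_isIso (baseChangeIsoApQuot K p t φ τ hτ).inv

/-- The base change is a NORMAL scheme (all local rings integrally closed): it is `Spec` of the normal domain
`L[u,y,z]/(u^p − yz)` (`isIntegrallyClosed_apQuot`). [folklore] -/
theorem isIntegrallyClosed_stalk_baseChange (y : ↥(pullback (surfTo K p t) (Spec.map (CommRingCat.ofHom φ)))) :
    IsIntegrallyClosed ((pullback (surfTo K p t) (Spec.map (CommRingCat.ofHom φ))).presheaf.stalk y) := by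
  haveI := isDomain_apQuot L p
  haveI := isIntegrallyClosed_apQuot L p
  let e := baseChangeIsoApQuot K p t φ τ hτ
  haveI := Literature.AlgebraicGeometry.Motives.isIntegrallyClosed_stalk_Spec (.of (ApQuot L p)) (e.hom.base y)
  exact IsIntegrallyClosed.of_equiv (asIso (e.hom.stalkMap y)).commRingCatIsoToRingEquiv

/-- The base change is NOT smooth over `L` (nor regular): `Spec L[u,y,z]/(u^p − yz)` smooth over `L` would have
regular local rings (Stacks 056S), contradicting `not_isRegularRing_apQuot`. [folklore] -/
theorem not_smooth_baseChange : ¬ Smooth (pullback.snd (surfTo K p t) (Spec.map (CommRingCat.ofHom φ))) := by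
  intro hsm
  let e := baseChangeIsoApQuot K p t φ τ hτ
  have h2 : Smooth (Spec.map (CommRingCat.ofHom (algebraMap L (ApQuot L p)))) := by
    have h1 := MorphismProperty.RespectsIso.precomp (P := @Smooth) e.inv
      (pullback.snd (surfTo K p t) (Spec.map (CommRingCat.ofHom φ))) hsm
    rwa [← baseChangeIsoApQuot_hom_comp K p t φ τ hτ, Iso.inv_hom_id_assoc] at h1
  have hreg : Scheme.IsRegular (Spec (.of (ApQuot L p))) := fun x =>
    @isRegularLocalRing_stalk_of_smooth_of_field L _ _ _ h2 x
  exact not_isRegularRing_apQuot L p ((Scheme.isRegular_Spec_iff (.of (ApQuot L p))).mp hreg)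

/-- **No FINITE birational modification of the base change is smooth over `L`** (it is normal, so the
modification is an isomorphism — tree `isIso_of_isFinite_of_isBirational` — and it is not smooth). [folklore] -/
theorem no_smooth_finite_model_baseChange (Y' : Scheme.{0}) [IsIntegral Y']
    (ν : Y' ⟶ pullback (surfTo K p t) (Spec.map (CommRingCat.ofHom φ))) [IsFinite ν] (hν : IsBirational ν)
    (hsm : Smooth (ν ≫ pullback.snd (surfTo K p t) (Spec.map (CommRingCat.ofHom φ)))) : False := by
  haveI := isIntegral_baseChange K p t φ τ hτ
  haveI : IsIso ν := isIso_of_isFinite_of_isBirational ν (isIntegrallyClosed_stalk_baseChange K p t φ τ hτ) hν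
  have h := MorphismProperty.RespectsIso.precomp (P := @Smooth) (inv ν) _ hsm
  rw [IsIso.inv_hom_id_assoc] at h
  exact not_smooth_baseChange K p t φ τ hτ h

end BaseChangeFacts

/-! ## §9 The Frobenius twists of level `≥ 1`, and `Y_t` itself -/

section Twists

variable (K : Type) [Field K] (p : ℕ) [hp : Fact p.Prime] [CharP K p] (t : K)

/-- `(t^{p^k})^p = Frob^{k+1}(t)`. [folklore] -/
theorem pow_pow_eq_iterateFrobenius (k : ℕ) : (t ^ p ^ k) ^ p = iterateFrobenius K p (k + 1) t := by
  rw [iterateFrobenius_def, pow_succ, pow_mul]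

/-- **[OURS · L1 W8.2] NORMALISING THE FROBENIUS TWISTS NEVER SUFFICES (dimension 2).** For every prime `p`, every
field `K` of characteristic `p`, every `t ∈ K` and every level `m = k + 1 ≥ 1`: the Frobenius twist
`Y_t ×_{K,Frob^m} Spec K` of the surface `Y_t : x^p − t = yz` is `Spec K[u,y,z]/(u^p − yz)` — integral and
NORMAL but NOT smooth over `K` — so NO FINITE birational modification `ν : Y' → Y_t ×_{K,Frob^m} Spec K` with
`Y'` integral (the normalisation, `ν = 𝟙`, …) is smooth over `K`. Contrast: for curves, normalising a twist of
high enough level does smooth (`hasSmoothFrobeniusTwistModel_of_dim_le_one`), and for `Y_t` a smooth proper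
birational model of a twist EXISTS (`hasSmoothFrobeniusTwistModel_surf`, given F-02) — it resolves the
`A_{p−1}` point. Reading for slot W8.2: from dimension `2` on, the residual (`CampaignW82.FrobeniusTwistStepRegularAt
p M n`) needs genuine RESOLUTION (blow-ups) at the twisted levels, not normalisation (Disproof.lean near-miss (s2) =
strategist census N3, here kernel-checked in the split form, every `p`). Replaces the role of no printed item; NOT a
statement of H. Hironaka's manuscript. [folklore] -/
theorem no_smooth_finite_model_twist (k : ℕ) (Y' : Scheme.{0}) [IsIntegral Y']
    (ν : Y' ⟶ pullback (surfTo K p t) (Spec.map (CommRingCat.ofHom (iterateFrobenius K p (k + 1)))))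
    [IsFinite ν] (hν : IsBirational ν)
    (hsm : Smooth (ν ≫ pullback.snd (surfTo K p t) (Spec.map (CommRingCat.ofHom (iterateFrobenius K p (k + 1)))))) :
    False :=
  no_smooth_finite_model_baseChange K p t (iterateFrobenius K p (k + 1)) (t ^ p ^ k)
    (pow_pow_eq_iterateFrobenius K p t k) Y' ν hν hsm

/-- The twists of level `≥ 1` are integral … [folklore] -/
theorem isIntegral_twist (k : ℕ) :
    IsIntegral (pullback (surfTo K p t) (Spec.map (CommRingCat.ofHom (iterateFrobenius K p (k + 1))))) :=
  isIntegral_baseChange K p t _ _ (pow_pow_eq_iterateFrobenius K p t k)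

/-- … NORMAL … [folklore] -/
theorem isIntegrallyClosed_stalk_twist (k : ℕ)
    (y : ↥(pullback (surfTo K p t) (Spec.map (CommRingCat.ofHom (iterateFrobenius K p (k + 1)))))) :
    IsIntegrallyClosed
      ((pullback (surfTo K p t) (Spec.map (CommRingCat.ofHom (iterateFrobenius K p (k + 1))))).presheaf.stalk y) :=
  isIntegrallyClosed_stalk_baseChange K p t _ _ (pow_pow_eq_iterateFrobenius K p t k) y

/-- … and NOT smooth over `K`. [folklore] -/
theorem not_smooth_twist (k : ℕ) :
    ¬ Smooth (pullback.snd (surfTo K p t) (Spec.map (CommRingCat.ofHom (iterateFrobenius K p (k + 1))))) :=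
  not_smooth_baseChange K p t _ _ (pow_pow_eq_iterateFrobenius K p t k)

/-- **`Y_t` is integral over the perfect closure** (`IntegralOverPerfectClosure`): over `L = K^{perf} ∋ τ = t^{1/p}`,
`Y_t ×_K L ≅ Spec L[u,y,z]/(u^p − yz)`. [folklore] -/
theorem integralOverPerfectClosure_surf : IntegralOverPerfectClosure K (surfTo K p t) := by
  let E := AlgebraicClosure K
  let L : IntermediateField K E := perfectClosure K E
  haveI : CharP E p := charP_of_injective_algebraMap (algebraMap K E).injective p
  haveI : CharP L p := charP_of_injective_algebraMap (algebraMap K L).injective p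
  haveI : ExpChar K p := ExpChar.prime hp.out
  obtain ⟨σ, hσ⟩ : ∃ σ : E, σ ^ p = algebraMap K E t := IsAlgClosed.exists_pow_nat_eq _ hp.out.pos
  have hσL : σ ∈ L := (mem_perfectClosure_iff_pow_mem p).mpr ⟨1, ⟨t, by rw [pow_one]; exact hσ.symm⟩⟩
  let τ : L := ⟨σ, hσL⟩
  have hτ : τ ^ p = algebraMap K L t := Subtype.ext hσ
  exact ⟨L, inferInstance, inferInstance, inferInstance, inferInstance,
    isIntegral_baseChange K p t (algebraMap K (L : Type)) τ hτ⟩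

/-- `Y_t` is an integral scheme. [folklore] -/
theorem isIntegral_surf : IsIntegral (surf K p t) :=
  (integralOverPerfectClosure_surf K p t).isIntegral

omit hp [CharP K p] in
/-- `Y_t ⟶ Spec K` is locally of finite type. [folklore] -/
theorem locallyOfFiniteType_surfTo : LocallyOfFiniteType (surfTo K p t) :=
  locallyOfFiniteType_hypTo K (surfPoly K p t)

omit hp [CharP K p] in
/-- `h_t ≠ 0` (its values at `(1,0,0)` and `(0,0,0)` differ by `1`). [folklore] -/
theorem surfPoly_ne_zero (hp0 : p ≠ 0) : surfPoly K p t ≠ 0 := by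
  intro h
  have h1 := congrArg (MvPolynomial.eval ![(1 : K), 0, 0]) h
  have h2 := congrArg (MvPolynomial.eval ![(0 : K), 0, 0]) h
  simp [surfPoly, hp0] at h1 h2
  rw [h2, sub_zero] at h1
  exact one_ne_zero h1

omit hp [CharP K p] in
/-- **`dim Y_t ≤ 2`** (`K[x,y,z]` has dimension `3`, `h_t` is a non-zero-divisor). [folklore] -/
theorem topologicalKrullDim_surf_le_two (hp0 : p ≠ 0) : topologicalKrullDim ↥(surf K p t) ≤ 2 := by
  change topologicalKrullDim (PrimeSpectrum (HypRing K (surfPoly K p t))) ≤ 2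
  rw [PrimeSpectrum.topologicalKrullDim_eq_ringKrullDim]
  have h := ringKrullDim_quotient_succ_le_of_nonZeroDivisor
    (mem_nonZeroDivisors_of_ne_zero (surfPoly_ne_zero K p t hp0))
  rw [MvPolynomial.ringKrullDim_of_isNoetherianRing, ringKrullDim_eq_zero_of_field] at h
  revert h
  generalize ringKrullDim (HypRing K (surfPoly K p t)) = d
  intro h
  induction d using WithBot.recBotCoe with
  | bot => exact bot_le
  | coe d =>
    induction d using ENat.recTopCoe with
    | top => exact absurd h (by decide)
    | coe d =>
      have : (d : WithBot ℕ∞) + 1 ≤ (3 : ℕ) := by simpa using h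
      have h' : d + 1 ≤ 3 := by exact_mod_cast this
      have h'' : (d : WithBot ℕ∞) ≤ (2 : ℕ) := by exact_mod_cast (show d ≤ 2 by omega)
      simpa using h''

/-- **`Y_t` is NOT smooth over `K`** (any `t`): its base change to `K̄ ∋ t^{1/p}` is the non-smooth
`Spec K̄[u,y,z]/(u^p − yz)`. (For `t ∉ K^p`, `Y_t` is nevertheless REGULAR — a regular non-smooth surface, the
two-dimensional sibling of Kollár's curve; at the point `(x^p = t, y = z = 0)` its maximal ideal is `(y, z)`.)
[folklore] -/
theorem not_smooth_surfTo : ¬ Smooth (surfTo K p t) := by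
  intro hsm
  let E := AlgebraicClosure K
  haveI : CharP E p := charP_of_injective_algebraMap (algebraMap K E).injective p
  obtain ⟨τ, hτ⟩ : ∃ τ : E, τ ^ p = algebraMap K E t := IsAlgClosed.exists_pow_nat_eq _ hp.out.pos
  exact not_smooth_baseChange K p t (algebraMap K E) τ hτ inferInstance

/-- **`Y_t` has a smooth proper birational model of SOME Frobenius twist, CONDITIONAL on FACT-LIST F-02**
(`hCP : CossartPiltant2019`; through res-L1-s82-pv-1's rung `hasSmoothFrobeniusTwistModel_of_dim_le_three`):
the `∃`-model of the residual exists for `Y_t` — a RESOLUTION of the `A_{p−1}` surface, not its normalisation.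
[cite: CossartPiltant2019, Thm. 1.1] -/
theorem hasSmoothFrobeniusTwistModel_surf (hCP : CossartPiltant2019.{0}) :
    HasSmoothFrobeniusTwistModel p K (surfTo K p t) :=
  haveI := locallyOfFiniteType_surfTo K p t
  hasSmoothFrobeniusTwistModel_of_dim_le_three hCP p K (surfTo K p t)
    ((topologicalKrullDim_surf_le_two K p t hp.out.ne_zero).trans (by decide))
    (integralOverPerfectClosure_surf K p t)

end Twists

end Summit.ResolutionOfSingularities.ResolutionOfSingularities.Theorems.CampaignW82.TwistNormal

end
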